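import Summits.RiemannHypothesis.RiemannHypothesis.Theorems.XiDiscComparisonDefs
import Literature.NumberTheory.LFunctions.XiModulusMonotone
import HarnessLib

/-!
# The scale of the modulus test `‖ξ(s)‖ < ‖ξ(s + 2c)‖` (`Re s > ½`): RH-FREE / RH-HARD / RH-EQUIVALENT

LINE 1 / LABEL: `ModulusTest c` is RH-FREE and PROVED for `c ≥ 1/(2√2)` (`XiDiscComparison.modulusTest_holds`);
for `c < 1/4` it is RH-HARD (it forces the quasi-Riemann hypothesis `Re ρ ≤ ½ + 2c`, `quasiRH_of_modulusTest` below);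
«`∀ c > 0, ModulusTest c`» is RH-EQUIVALENT (`riemannHypothesis_iff_forall_modulusTest` below = Sondow–Dumitrescu's
Corollary 1 in the tree, `SondowDumitrescu2010.riemannHypothesis_iff_norm_riemannXi_strictMonoOn`, re-packaged). Recording
the two non-free sides completes idea-2 g3's "modulus face" (HOME/rh-dbr-idea-2/g3-Sketch.lean) in the tree; they are
bookkeeping, NOT progress toward RH, and the RH-equivalence is a criterion in costume, not a claim. bears_on: LADDER-RH
B-P(P2)/(P3). WHAT THIS IS NOT: no statement here bears on the truth of RH.
-/

noncomputable section

set_option linter.dupNamespace false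

open Complex Set

namespace Summit.RiemannHypothesis.RiemannHypothesis.Theorems.XiDiscComparison

open Literature.NumberTheory.LFunctions

/-- RH-HARD side of the scale (idea-2 g3, verbatim): the modulus test at scale `c` forces `Re ρ ≤ ½ + 2c` for every
zero `ρ` of `ξ` (take `s = ρ − 2c`). For `c < ¼` this is an open zero-free half-plane. -/
theorem quasiRH_of_modulusTest {c : ℝ} (h : ModulusTest c) :
    ∀ ρ : ℂ, riemannXi ρ = 0 → ρ.re ≤ 1 / 2 + 2 * c := by
  intro ρ hρ
  by_contra hlt
  push Not at hlt
  have key := h (ρ - 2 * c) (by simp; linarith)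
  have e : ρ - 2 * (c : ℂ) + 2 * c = ρ := by ring
  rw [e, hρ, norm_zero] at key
  exact (not_lt.mpr (norm_nonneg _)) key

/-- RH-EQUIVALENT bottom of the scale (idea-2 g3, verbatim; a criterion in costume, NOT a claim): the modulus test at
every scale `c > 0` is Sondow–Dumitrescu's horizontal monotonicity of `‖ξ‖` on `Re s > ½`, i.e. `RiemannHypothesis`.
[cite: SondowDumitrescu2010, Cor 1] -/
theorem riemannHypothesis_iff_forall_modulusTest :
    _root_.RiemannHypothesis ↔ ∀ c : ℝ, 0 < c → ModulusTest c := by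
  rw [SondowDumitrescu2010.riemannHypothesis_iff_norm_riemannXi_strictMonoOn]
  constructor
  · intro hmono c hc s hs
    have key := hmono s.im (show s.re ∈ Ioi (1 / 2 : ℝ) from hs)
      (show s.re + 2 * c ∈ Ioi (1 / 2 : ℝ) by simp only [mem_Ioi]; linarith)
      (by linarith : s.re < s.re + 2 * c)
    have e1 : ((s.re : ℂ) + s.im * I) = s := Complex.re_add_im s
    have e2 : (((s.re + 2 * c : ℝ) : ℂ) + s.im * I) = s + 2 * c := by
      apply Complex.ext <;> simp
    simp only at key
    rw [e1, e2] at key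
    exact key
  · intro h t a ha b hb hab
    have hc : 0 < (b - a) / 2 := by linarith
    have key := h ((b - a) / 2) hc ((a : ℂ) + t * I) (by simpa using ha)
    have e : ((a : ℂ) + t * I) + 2 * (((b - a) / 2 : ℝ) : ℂ) = (b : ℂ) + t * I := by
      push_cast; ring
    rw [e] at key
    exact key

/-- The RH-FREE range in one line: for `c ≥ 1/(2√2)` the modulus test holds, and it already pins every zero of `ξ` to
`Re ρ ≤ ½ + 2c` (vacuous there: `½ + 2c ≥ ½ + 1/√2 > 1`) — the pair-by-pair method cannot reach a zero-free region. -/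
theorem modulusTest_scale_summary {c : ℝ} (hc : 1 / (2 * Real.sqrt 2) ≤ c) :
    ModulusTest c ∧ ∀ ρ : ℂ, riemannXi ρ = 0 → ρ.re ≤ 1 / 2 + 2 * c :=
  ⟨modulusTest_holds hc, quasiRH_of_modulusTest (modulusTest_holds hc)⟩

end Summit.RiemannHypothesis.RiemannHypothesis.Theorems.XiDiscComparison
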